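import Summits.Ventures.PercRepro.RankLevelSetLevelThirteenGXTFormXO
import Summits.Ventures.PercRepro.RankLevelSetLevelThirteenGXTFormXP
import Summits.Ventures.PercRepro.RankLevelSetLevelThirteenGXTFormXQ
import Summits.Ventures.PercRepro.RankLevelSetLevelThirteenGXTFormXR
import Summits.Ventures.PercRepro.RankLevelSetLevelThirteenGXTFormXS
import Summits.Ventures.PercRepro.RankLevelSetLevelThirteenGXTFormXT
import Summits.Ventures.PercRepro.RankLevelSetLevelThirteenGXTFormXU
import Summits.Ventures.PercRepro.RankLevelSetLevelThirteenGXTFormXV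
import Summits.Ventures.PercRepro.RankLevelSetLevelThirteenGXTFormXW
import Summits.Ventures.PercRepro.RankLevelSetLevelThirteenGXTFormXX
import Summits.Ventures.PercRepro.RankLevelSetLevelThirteenGXTFormXY
import Summits.Ventures.PercRepro.RankLevelSetLevelThirteenGXTFormXZ
import Summits.Ventures.PercRepro.RankLevelSetLevelThirteenGXTFormWA
import Summits.Ventures.PercRepro.RankLevelSetLevelThirteenGXTFormWB
import Summits.Ventures.PercRepro.RankLevelSetLevelThirteenGXTFormWC
import Summits.Ventures.PercRepro.RankLevelSetLevelThirteenGXTFormWD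
import Summits.Ventures.PercRepro.RankLevelSetLevelThirteenGXTFormWE
import Summits.Ventures.PercRepro.RankLevelSetLevelThirteenGXTFormWF
import Summits.Ventures.PercRepro.RankLevelSetLevelThirteenGXTFormWG
import Summits.Ventures.PercRepro.RankLevelSetLevelThirteenGXTFormWH
import Summits.Ventures.PercRepro.RankLevelSetLevelThirteenGXTFormWI
import Summits.Ventures.PercRepro.RankLevelSetLevelThirteenGXTFormWJ
import Summits.Ventures.PercRepro.RankLevelSetLevelThirteenGXTFormWK
import Summits.Ventures.PercRepro.RankLevelSetLevelThirteenGXTFormWL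
import Summits.Ventures.PercRepro.RankLevelSetLevelThirteenGXTFormWM
import Summits.Ventures.PercRepro.RankLevelSetLevelThirteenGXTFormWN
import Summits.Ventures.PercRepro.RankLevelSetLevelThirteenGXTFormWO
import Summits.Ventures.PercRepro.RankLevelSetLevelThirteenGXTFormWP
import Summits.Ventures.PercRepro.RankLevelSetLevelThirteenGXTFormWQ
import Summits.Ventures.PercRepro.RankLevelSetLevelThirteenGXTFormWR
import Summits.Ventures.PercRepro.RankLevelSetLevelThirteenGXTFormWS
import Summits.Ventures.PercRepro.RankLevelSetLevelThirteenGXTFormWT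
import Summits.Ventures.PercRepro.RankLevelSetLevelThirteenGXTFormWU
import Summits.Ventures.PercRepro.RankLevelSetLevelThirteenGXTFormWV
import Summits.Ventures.PercRepro.RankLevelSetLevelThirteenGXTFormWW
import Summits.Ventures.PercRepro.RankLevelSetLevelThirteenGXTFormWX
import Summits.Ventures.PercRepro.RankLevelSetLevelThirteenGXTFormWY
import Summits.Ventures.PercRepro.RankLevelSetLevelThirteenGXTFormWZ
import Summits.Ventures.PercRepro.RankLevelSetLevelThirteenGXTFormVA
import Summits.Ventures.PercRepro.RankLevelSetLevelThirteenGXTFormVB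
import Summits.Ventures.PercRepro.RankLevelSetLevelThirteenGXTFormVC
import Summits.Ventures.PercRepro.RankLevelSetLevelThirteenGXTFormVD
import Summits.Ventures.PercRepro.RankLevelSetLevelThirteenGXTFormVE
import Summits.Ventures.PercRepro.RankLevelSetLevelThirteenGXTFormVF
import Summits.Ventures.PercRepro.RankLevelSetLevelThirteenGXTFormVG
import Summits.Ventures.PercRepro.RankLevelSetLevelThirteenGXTFormVH
import Summits.Ventures.PercRepro.RankLevelSetLevelThirteenGXTFormVI
import Summits.Ventures.PercRepro.RankLevelSetLevelThirteenGXTFormVJ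
import Summits.Ventures.PercRepro.RankLevelSetLevelThirteenGXTFormVK
import Summits.Ventures.PercRepro.RankLevelSetLevelThirteenGXTFormVL
import Summits.Ventures.PercRepro.RankLevelSetLevelThirteenGXTFormVM
import Summits.Ventures.PercRepro.RankLevelSetLevelThirteenGXTFormVN
import Summits.Ventures.PercRepro.RankLevelSetLevelThirteenGXTFormVO
import Summits.Ventures.PercRepro.RankLevelSetLevelThirteenGXTFormVP
import Summits.Ventures.PercRepro.RankLevelSetLevelThirteenGXTFormVQ
import Summits.Ventures.PercRepro.RankLevelSetLevelThirteenGXTFormVR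
import Summits.Ventures.PercRepro.RankLevelSetLevelThirteenGXTFormVS
import Summits.Ventures.PercRepro.RankLevelSetLevelThirteenGXTFormVT
import Summits.Ventures.PercRepro.RankLevelSetLevelThirteenGXTFormVU
import Summits.Ventures.PercRepro.RankLevelSetLevelThirteenGXTFormVV
import Summits.Ventures.PercRepro.RankLevelSetLevelThirteenGXTFormVW
import Summits.Ventures.PercRepro.RankLevelSetLevelThirteenGXTFormVX
import Summits.Ventures.PercRepro.RankLevelSetLevelThirteenGXTFormVY
import Summits.Ventures.PercRepro.RankLevelSetLevelThirteenGXTFormVZ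
import Summits.Ventures.PercRepro.RankLevelSetLevelThirteenGXTFormUA
import Summits.Ventures.PercRepro.RankLevelSetLevelThirteenGXTFormUB

/-!
# PercRepro — THE LEVEL-`13` DISPATCHER OF THE GXT CHAIN (THE GIANT-EXACT COUNT WITH LEMMA T5) AT BASE `4027`, UPPER HALF: the per-corank
form `(c₁, c₂)`, `(P_d^gxt)` and the `Y`-tail for `2654 ≤ d ≤ 5257` (p2, gen 37; a feeder for S4 — the top of the `q = 13` window, from
`5,400`). The 66 parts XO … UB (the whole dispatcher `gxt_form_thirteen` is split in two halves by the 400-line limit). Axioms: standard.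
-/

set_option exponentiation.threshold 16384

namespace PercRepro

namespace ThmN

/-- The upper half of the per-corank form of the level-`13` GXT chain at base `4027`: the coranks `2654 ≤ d ≤ 5257`. -/
theorem gxt_form_thirteen_hi (d : ℕ) (hd1 : 2654 ≤ d) (hd2 : d ≤ 5257) (p : ℕ) (hp : 4027 ≤ p) (n : ℕ) (hn : 4027 + d ≤ n) :
    ∃ c₁ c₂ : ℕ, 0 < c₂ ∧ c₂ < c₁ ∧
    ((c₁ : ℕ) : ℚ) * ((((p + d).choose 13 : ℕ) : ℚ) + (∑ j ∈ Finset.range (min (d - 13) 60), ((Nat.choose (min 5105 (max ((d + min 2547 d) / 2 + 1) (min 2546 (d - 1) + 2) - 2)) j : ℕ) : ℚ) / (((j + 1) + 3 * (j + 1).choose 2 + 3 * (j + 1).choose 3 + 2 * (j + 1).choose 4 : ℕ) : ℚ) + (if 60 < d - 13 then (66 / 5 : ℚ) * 2 ^ (min 5105 (max ((d + min 2547 d) / 2 + 1) (min 2546 (d - 1) + 2) - 2) + 4) / ((((min 5105 (max ((d + min 2547 d) / 2 + 1) (min 2546 (d - 1) + 2) - 2)) + 1) * ((min 5105 (max ((d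 + min 2547 d) / 2 + 1) (min 2546 (d - 1) + 2) - 2)) + 2) * ((min 5105 (max ((d + min 2547 d) / 2 + 1) (min 2546 (d - 1) + 2) - 2)) + 3) * ((min 5105 (max ((d + min 2547 d) / 2 + 1) (min 2546 (d - 1) + 2) - 2)) + 4) : ℕ) : ℚ) else 0)) *
      (((d * (d + 1) / 2 : ℕ) : ℚ) * ((p + d).choose 11 : ℚ) + ((d * (d + 1) * (d + 2) / 3 : ℕ) : ℚ) * ((p + d).choose 10 : ℚ) + ((7 * d * (d + 1) * (d + 2) * (d + 3) / 48 : ℕ) : ℚ) * ((p + d).choose 9 : ℚ) + (((d + 5).choose 6 : ℕ) : ℚ) * ((p + d).choose 8 : ℚ) + (((d + 6).choose 7 : ℕ) : ℚ) * ((p + d).choose 7 : ℚ) + (((d + 7).choose 8 : ℕ) : ℚ) * ((p + d).choose 6 : ℚ) + (((d + 8).choose 9 : ℕ) : ℚ) * ((p + d).choose 5 : ℚ) + (((d + 9).choose 10 : ℕ) : ℚ) * ((p + d).choose 4 : ℚ) + (((d + 10).choose 11 : ℕ) : ℚ) * ((p + d).choose 3 : ℚ) + (((d + 11).choose 12 :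 ℕ) : ℚ) * ((p + d).choose 2 : ℚ) + (((d + 12).choose 13 : ℕ) : ℚ) * (p + d : ℚ) + (((d + 13).choose 14 : ℕ) : ℚ)) +
      (2 : ℚ) ^ (min 5119 (13 + d))) ≤
      ((c₂ : ℕ) : ℚ) * 2 ^ (d - 13) * (((p + 13).choose 13 : ℕ) : ℚ) ∧
      c₁ * (n.choose 13 * 2 ^ (min 5106 d) + n.choose 12 * 2 ^ 2547 + n.choose 11 * 2 ^ 1268 + n.choose 10 * 2 ^ 629 + n.choose 9 * 2 ^ 310 + n.choose 8 * 2 ^ 151 + n.choose 7 * 2 ^ 72 + n.choose 6 * 2 ^ 33 + n.choose 5 * 2 ^ 14 + n.choose 4 * 2 ^ 6 + n.choose 3 * 2 ^ 3 + n.choose 2 * 2 + n + 1 + ∑ j ∈ Finset.range (d + 1), n.choose j) ≤ (c₁ - c₂) * 2 ^ n := by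
  rcases Nat.lt_or_ge d (2693 + 1) with h0 | h0
  · exact gxt_form_thirteen_XO d hd1 (by omega) p hp n hn
  rcases Nat.lt_or_ge d (2733 + 1) with h1 | h1
  · exact gxt_form_thirteen_XP d (by omega) (by omega) p hp n hn
  rcases Nat.lt_or_ge d (2773 + 1) with h2 | h2
  · exact gxt_form_thirteen_XQ d (by omega) (by omega) p hp n hn
  rcases Nat.lt_or_ge d (2813 + 1) with h3 | h3
  · exact gxt_form_thirteen_XR d (by omega) (by omega) p hp n hn
  rcases Nat.lt_or_ge d (2853 + 1) with h4 | h4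
  · exact gxt_form_thirteen_XS d (by omega) (by omega) p hp n hn
  rcases Nat.lt_or_ge d (2893 + 1) with h5 | h5
  · exact gxt_form_thirteen_XT d (by omega) (by omega) p hp n hn
  rcases Nat.lt_or_ge d (2933 + 1) with h6 | h6
  · exact gxt_form_thirteen_XU d (by omega) (by omega) p hp n hn
  rcases Nat.lt_or_ge d (2973 + 1) with h7 | h7
  · exact gxt_form_thirteen_XV d (by omega) (by omega) p hp n hn
  rcases Nat.lt_or_ge d (3013 + 1) with h8 | h8
  · exact gxt_form_thirteen_XW d (by omega) (by omega) p hp n hn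
  rcases Nat.lt_or_ge d (3053 + 1) with h9 | h9
  · exact gxt_form_thirteen_XX d (by omega) (by omega) p hp n hn
  rcases Nat.lt_or_ge d (3093 + 1) with h10 | h10
  · exact gxt_form_thirteen_XY d (by omega) (by omega) p hp n hn
  rcases Nat.lt_or_ge d (3133 + 1) with h11 | h11
  · exact gxt_form_thirteen_XZ d (by omega) (by omega) p hp n hn
  rcases Nat.lt_or_ge d (3173 + 1) with h12 | h12
  · exact gxt_form_thirteen_WA d (by omega) (by omega) p hp n hn
  rcases Nat.lt_or_ge d (3213 + 1) with h13 | h13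
  · exact gxt_form_thirteen_WB d (by omega) (by omega) p hp n hn
  rcases Nat.lt_or_ge d (3253 + 1) with h14 | h14
  · exact gxt_form_thirteen_WC d (by omega) (by omega) p hp n hn
  rcases Nat.lt_or_ge d (3293 + 1) with h15 | h15
  · exact gxt_form_thirteen_WD d (by omega) (by omega) p hp n hn
  rcases Nat.lt_or_ge d (3333 + 1) with h16 | h16
  · exact gxt_form_thirteen_WE d (by omega) (by omega) p hp n hn
  rcases Nat.lt_or_ge d (3373 + 1) with h17 | h17
  · exact gxt_form_thirteen_WF d (by omega) (by omega) p hp n hn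
  rcases Nat.lt_or_ge d (3413 + 1) with h18 | h18
  · exact gxt_form_thirteen_WG d (by omega) (by omega) p hp n hn
  rcases Nat.lt_or_ge d (3453 + 1) with h19 | h19
  · exact gxt_form_thirteen_WH d (by omega) (by omega) p hp n hn
  rcases Nat.lt_or_ge d (3493 + 1) with h20 | h20
  · exact gxt_form_thirteen_WI d (by omega) (by omega) p hp n hn
  rcases Nat.lt_or_ge d (3533 + 1) with h21 | h21
  · exact gxt_form_thirteen_WJ d (by omega) (by omega) p hp n hn
  rcases Nat.lt_or_ge d (3573 + 1) with h22 | h22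
  · exact gxt_form_thirteen_WK d (by omega) (by omega) p hp n hn
  rcases Nat.lt_or_ge d (3613 + 1) with h23 | h23
  · exact gxt_form_thirteen_WL d (by omega) (by omega) p hp n hn
  rcases Nat.lt_or_ge d (3653 + 1) with h24 | h24
  · exact gxt_form_thirteen_WM d (by omega) (by omega) p hp n hn
  rcases Nat.lt_or_ge d (3693 + 1) with h25 | h25
  · exact gxt_form_thirteen_WN d (by omega) (by omega) p hp n hn
  rcases Nat.lt_or_ge d (3733 + 1) with h26 | h26
  · exact gxt_form_thirteen_WO d (by omega) (by omega) p hp n hn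
  rcases Nat.lt_or_ge d (3773 + 1) with h27 | h27
  · exact gxt_form_thirteen_WP d (by omega) (by omega) p hp n hn
  rcases Nat.lt_or_ge d (3813 + 1) with h28 | h28
  · exact gxt_form_thirteen_WQ d (by omega) (by omega) p hp n hn
  rcases Nat.lt_or_ge d (3853 + 1) with h29 | h29
  · exact gxt_form_thirteen_WR d (by omega) (by omega) p hp n hn
  rcases Nat.lt_or_ge d (3893 + 1) with h30 | h30
  · exact gxt_form_thirteen_WS d (by omega) (by omega) p hp n hn
  rcases Nat.lt_or_ge d (3933 + 1) with h31 | h31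
  · exact gxt_form_thirteen_WT d (by omega) (by omega) p hp n hn
  rcases Nat.lt_or_ge d (3973 + 1) with h32 | h32
  · exact gxt_form_thirteen_WU d (by omega) (by omega) p hp n hn
  rcases Nat.lt_or_ge d (4013 + 1) with h33 | h33
  · exact gxt_form_thirteen_WV d (by omega) (by omega) p hp n hn
  rcases Nat.lt_or_ge d (4053 + 1) with h34 | h34
  · exact gxt_form_thirteen_WW d (by omega) (by omega) p hp n hn
  rcases Nat.lt_or_ge d (4093 + 1) with h35 | h35
  · exact gxt_form_thirteen_WX d (by omega) (by omega) p hp n hn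
  rcases Nat.lt_or_ge d (4133 + 1) with h36 | h36
  · exact gxt_form_thirteen_WY d (by omega) (by omega) p hp n hn
  rcases Nat.lt_or_ge d (4173 + 1) with h37 | h37
  · exact gxt_form_thirteen_WZ d (by omega) (by omega) p hp n hn
  rcases Nat.lt_or_ge d (4213 + 1) with h38 | h38
  · exact gxt_form_thirteen_VA d (by omega) (by omega) p hp n hn
  rcases Nat.lt_or_ge d (4253 + 1) with h39 | h39
  · exact gxt_form_thirteen_VB d (by omega) (by omega) p hp n hn
  rcases Nat.lt_or_ge d (4293 + 1) with h40 | h40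
  · exact gxt_form_thirteen_VC d (by omega) (by omega) p hp n hn
  rcases Nat.lt_or_ge d (4333 + 1) with h41 | h41
  · exact gxt_form_thirteen_VD d (by omega) (by omega) p hp n hn
  rcases Nat.lt_or_ge d (4373 + 1) with h42 | h42
  · exact gxt_form_thirteen_VE d (by omega) (by omega) p hp n hn
  rcases Nat.lt_or_ge d (4413 + 1) with h43 | h43
  · exact gxt_form_thirteen_VF d (by omega) (by omega) p hp n hn
  rcases Nat.lt_or_ge d (4453 + 1) with h44 | h44
  · exact gxt_form_thirteen_VG d (by omega) (by omega) p hp n hn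
  rcases Nat.lt_or_ge d (4493 + 1) with h45 | h45
  · exact gxt_form_thirteen_VH d (by omega) (by omega) p hp n hn
  rcases Nat.lt_or_ge d (4533 + 1) with h46 | h46
  · exact gxt_form_thirteen_VI d (by omega) (by omega) p hp n hn
  rcases Nat.lt_or_ge d (4573 + 1) with h47 | h47
  · exact gxt_form_thirteen_VJ d (by omega) (by omega) p hp n hn
  rcases Nat.lt_or_ge d (4613 + 1) with h48 | h48
  · exact gxt_form_thirteen_VK d (by omega) (by omega) p hp n hn
  rcases Nat.lt_or_ge d (4653 + 1) with h49 | h49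
  · exact gxt_form_thirteen_VL d (by omega) (by omega) p hp n hn
  rcases Nat.lt_or_ge d (4693 + 1) with h50 | h50
  · exact gxt_form_thirteen_VM d (by omega) (by omega) p hp n hn
  rcases Nat.lt_or_ge d (4733 + 1) with h51 | h51
  · exact gxt_form_thirteen_VN d (by omega) (by omega) p hp n hn
  rcases Nat.lt_or_ge d (4773 + 1) with h52 | h52
  · exact gxt_form_thirteen_VO d (by omega) (by omega) p hp n hn
  rcases Nat.lt_or_ge d (4813 + 1) with h53 | h53
  · exact gxt_form_thirteen_VP d (by omega) (by omega) p hp n hn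
  rcases Nat.lt_or_ge d (4853 + 1) with h54 | h54
  · exact gxt_form_thirteen_VQ d (by omega) (by omega) p hp n hn
  rcases Nat.lt_or_ge d (4893 + 1) with h55 | h55
  · exact gxt_form_thirteen_VR d (by omega) (by omega) p hp n hn
  rcases Nat.lt_or_ge d (4933 + 1) with h56 | h56
  · exact gxt_form_thirteen_VS d (by omega) (by omega) p hp n hn
  rcases Nat.lt_or_ge d (4973 + 1) with h57 | h57
  · exact gxt_form_thirteen_VT d (by omega) (by omega) p hp n hn
  rcases Nat.lt_or_ge d (5013 + 1) with h58 | h58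
  · exact gxt_form_thirteen_VU d (by omega) (by omega) p hp n hn
  rcases Nat.lt_or_ge d (5053 + 1) with h59 | h59
  · exact gxt_form_thirteen_VV d (by omega) (by omega) p hp n hn
  rcases Nat.lt_or_ge d (5093 + 1) with h60 | h60
  · exact gxt_form_thirteen_VW d (by omega) (by omega) p hp n hn
  rcases Nat.lt_or_ge d (5133 + 1) with h61 | h61
  · exact gxt_form_thirteen_VX d (by omega) (by omega) p hp n hn
  rcases Nat.lt_or_ge d (5173 + 1) with h62 | h62
  · exact gxt_form_thirteen_VY d (by omega) (by omega) p hp n hn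
  rcases Nat.lt_or_ge d (5213 + 1) with h63 | h63
  · exact gxt_form_thirteen_VZ d (by omega) (by omega) p hp n hn
  rcases Nat.lt_or_ge d (5253 + 1) with h64 | h64
  · exact gxt_form_thirteen_UA d (by omega) (by omega) p hp n hn
  · exact gxt_form_thirteen_UB d (by omega) hd2 p hp n hn

end ThmN

end PercRepro
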